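import Summits.ValiantsHypothesis.ValiantsHypothesis.Theorems.MonotoneRestorationOrbitRestorationQPValueDerivation
import HarnessLib

/-!
# Canonical hereditary terms of a value derivation (symmetrisation in ORBIT currency, II)

Route MonotoneRestoration, crux `OrbitRestorationQP` (stmt-ValiantsHypothesis-18293), namespace
`Summit.ValiantsHypothesis.ValiantsHypothesis.Theorems.ValueDerivation`.

Given a value derivation `𝒟` (`…ValueDerivation.lean`) and a finite group `Γ` acting on the variables,
attach to every value `q` of the `Γ`-closure `U` a CANONICAL normal hereditary term `tm q`
(`…HereditaryTerms.lean`) by AVERAGING the one-step unfoldings of ALL least-rank witnesses `(γ, p) ∈ W q`: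
`tm q = N_q⁻¹ · (0 + Σ_{(γ,p) ∈ W q} ⟦γ • (step of p)⟧)`, `N_q = |W q|`, the summands `c · u` of a
sum-step being spliced in flat as product nodes `c · tm (γ • u)`, a product-step `u · v` contributing one
binary product node `tm (γ • u) · tm (γ • v)`, a variable / constant step a leaf.  Because the witness set
`W q` is determined by `q`, no choice is involved and `q ↦ tm q` is `Γ`-equivariant (sequel
`…ValueTermsAction.lean`); the value of `tm q` is `q` (characteristic `0`).

* `mkNode b M` — a node over a MULTISET of children (sorted list); `act_mkNode`, `val_mkNode_false/true`;
* `contrib`, `summands`, `body`, `tmF` (fuel), `tm`; `tmF_eq_tm` (fuel independence), `tm_unfold`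
  (`tm q = body tm q`), `normalize_tm` (the terms are normal).

Everything is proved. [folklore]

## References
* A. Dawar, G. Wilsenach, *Symmetric arithmetic circuits*, ToC 21 (2025), Defs. 2.2, 3.6, 3.7, §3.3.
  [DawarWilsenach2025]
-/

noncomputable section

open scoped Classical

-- `Summit.ValiantsHypothesis.ValiantsHypothesis.…` is the tree's single-conjunct layout (Sub = Summit).
set_option linter.dupNamespace false

namespace Summit.ValiantsHypothesis.ValiantsHypothesis.Theorems

open HTerm

universe u v w


namespace ValueDerivation

variable {K : Type u} {X : Type v} [Field K] (𝒟 : ValueDerivation K X)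
variable {Γ : Type w} [Group Γ] [Fintype Γ] [MulAction Γ X]

/-! ### Nodes from multisets of normal terms -/

/-- The node with label `b` over the multiset `M` of children, sorted. [folklore] -/
def mkNode (b : Bool) (M : Multiset (HTerm K X)) : HTerm K X := HTerm.node b (tsort M.toList)

omit [Field K] in
/-- The children list of `mkNode b M` is `M` as a multiset. [folklore] -/
theorem coe_tsort_toList (M : Multiset (HTerm K X)) : (tsort M.toList : Multiset (HTerm K X)) = M := by
  rw [Multiset.coe_eq_coe.2 (tsort_perm M.toList), Multiset.coe_toList]

omit [Field K] in
/-- Membership in the children of `mkNode`. [folklore] -/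
theorem mem_tsort_toList {M : Multiset (HTerm K X)} {u : HTerm K X} : u ∈ tsort M.toList ↔ u ∈ M := by
  rw [← Multiset.mem_coe, coe_tsort_toList]

omit [Field K] in
/-- The number of children of `mkNode b M` is `card M`. [folklore] -/
theorem length_tsort_toList (M : Multiset (HTerm K X)) : (tsort M.toList).length = Multiset.card M := by
  rw [(tsort_perm M.toList).length_eq, Multiset.length_toList]

omit [Field K] in
/-- Counting in the children of `mkNode b M`. [folklore] -/
theorem count_tsort_toList (M : Multiset (HTerm K X)) (u : HTerm K X) :
    (tsort M.toList).count u = M.count u := by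
  rw [← Multiset.coe_count, coe_tsort_toList]

omit [Field K] in
/-- `mkNode` of normal children is normal. [folklore] -/
theorem normalize_mkNode (b : Bool) {M : Multiset (HTerm K X)} (hM : ∀ t ∈ M, normalize t = t) :
    normalize (mkNode b M) = mkNode b M := by
  rw [mkNode, normalize_node]
  congr 1
  have : (tsort M.toList).map normalize = (tsort M.toList).map id :=
    List.map_congr_left fun t ht => hM t (mem_tsort_toList.1 ht)
  rw [this, List.map_id, tsort_tsort]

omit [Field K] [Fintype Γ] in
/-- The action on `mkNode`: act on the children. [folklore] -/
theorem act_mkNode (δ : Γ) (b : Bool) (M : Multiset (HTerm K X)) :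
    act δ (mkNode b M) = mkNode b (M.map (act δ)) := by
  rw [mkNode, act_node, mkNode]
  congr 1
  apply tsort_eq_of_perm
  rw [← Multiset.coe_eq_coe, ← Multiset.map_coe, coe_tsort_toList, Multiset.coe_toList]

omit [Field K] in
/-- Value of a sum node over a multiset. [folklore] -/
theorem val_mkNode_false [CommSemiring K] (M : Multiset (HTerm K X)) :
    (mkNode false M).val = (M.map val).sum := by
  rw [mkNode, val_node_false, ← Multiset.sum_coe, ← Multiset.map_coe, coe_tsort_toList]

omit [Field K] in
/-- Value of a product node over a multiset. [folklore] -/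
theorem val_mkNode_true [CommSemiring K] (M : Multiset (HTerm K X)) :
    (mkNode true M).val = (M.map val).prod := by
  rw [mkNode, val_node_true, ← Multiset.prod_coe, ← Multiset.map_coe, coe_tsort_toList]

/-! ### The canonical terms -/

/-- The contribution of a (transported) step to the averaging sum, given terms `t` for its operands:
a variable / constant leaf, the scaled summands `c · t u` spliced in flat, or one product node
`t u · t v`. [folklore] -/
def contrib (t : MvPolynomial X K → HTerm K X) : StepData K X → Multiset (HTerm K X)
  | StepData.var x => {HTerm.var x}
  | StepData.const c => {HTerm.const c}
  | StepData.sum D => D.map fun cu => mkNode true {HTerm.const cu.1, t cu.2}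
  | StepData.prod u v => {mkNode true {t u, t v}}

variable (Γ) in
/-- The multiset of summands of the averaging node of `q`: a `0` and the contributions of all least-rank
witnesses. [folklore] -/
def summands (t : MvPolynomial X K → HTerm K X) (q : MvPolynomial X K) : Multiset (HTerm K X) :=
  ({HTerm.const 0} : Multiset (HTerm K X)) + ∑ w ∈ 𝒟.W Γ q, contrib t ((𝒟.stepOf w.2).map w.1)

variable (Γ) in
/-- The term of `q` given terms `t` for values of smaller rank:
`N_q⁻¹ · (0 + Σ_{least witnesses} contributions)`, `N_q = |W q|`. [folklore] -/
def body (t : MvPolynomial X K → HTerm K X) (q : MvPolynomial X K) : HTerm K X :=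
  mkNode true {HTerm.const (((𝒟.W Γ q).card : K)⁻¹), mkNode false (𝒟.summands Γ t q)}

variable (Γ) in
/-- The canonical terms with fuel. [folklore] -/
def tmF : ℕ → MvPolynomial X K → HTerm K X
  | 0 => fun _ => HTerm.const 0
  | k + 1 => fun q => 𝒟.body Γ (tmF k) q

variable (Γ) in
/-- **The canonical term of a value** (fuel `rU q + 1`). [folklore] -/
def tm (q : MvPolynomial X K) : HTerm K X := 𝒟.tmF Γ (𝒟.rU Γ q + 1) q

/-- The body only depends on the terms of the operands of the least-rank witnesses. [folklore] -/
theorem body_congr {t t' : MvPolynomial X K → HTerm K X} {q : MvPolynomial X K}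
    (h : ∀ w ∈ 𝒟.W Γ q, ∀ u ∈ ((𝒟.stepOf w.2).map w.1).args, t u = t' u) :
    𝒟.body Γ t q = 𝒟.body Γ t' q := by
  have hs : 𝒟.summands Γ t q = 𝒟.summands Γ t' q := by
    unfold summands
    congr 1
    refine Finset.sum_congr rfl fun w hw => ?_
    have hw' := h w hw
    rcases hd : (𝒟.stepOf w.2).map w.1 with x | c | D | ⟨u, v⟩
    · rfl
    · rfl
    · rw [hd] at hw'
      simp only [contrib]
      refine Multiset.map_congr rfl fun cu hcu => ?_
      rw [hw' cu.2 (by simpa [StepData.args] using ⟨cu.1, hcu⟩)]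
    · rw [hd] at hw'
      simp only [contrib]
      rw [hw' u (by simp [StepData.args]), hw' v (by simp [StepData.args])]
  rw [body, body, hs]

/-- **Fuel independence**: with enough fuel the term is the canonical one. [folklore] -/
theorem tmF_eq_tm : ∀ (k : ℕ) {q : MvPolynomial X K}, q ∈ 𝒟.U Γ → 𝒟.rU Γ q < k → 𝒟.tmF Γ k q = 𝒟.tm Γ q := by
  intro k
  induction k using Nat.strong_induction_on with
  | _ k ih =>
    intro q hq hk
    obtain ⟨k, rfl⟩ : ∃ k', k = k' + 1 := ⟨k - 1, by omega⟩
    change 𝒟.body Γ (𝒟.tmF Γ k) q = 𝒟.body Γ (𝒟.tmF Γ (𝒟.rU Γ q)) q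
    refine 𝒟.body_congr fun w hw u hu => ?_
    obtain ⟨huU, hlt⟩ := 𝒟.args_step_W hw hu
    rw [ih k (by omega) huU (by omega), ih (𝒟.rU Γ q) (by omega) huU hlt]

/-- **The canonical term unfolded**: `tm q = N_q⁻¹ · (0 + Σ contributions with tm at the operands)`.
[folklore] -/
theorem tm_unfold (q : MvPolynomial X K) : 𝒟.tm Γ q = 𝒟.body Γ (𝒟.tm Γ) q := by
  change 𝒟.body Γ (𝒟.tmF Γ (𝒟.rU Γ q)) q = _
  refine 𝒟.body_congr fun w hw u hu => ?_
  obtain ⟨huU, hlt⟩ := 𝒟.args_step_W hw hu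
  exact 𝒟.tmF_eq_tm _ huU hlt

/-- Members of a contribution over normal terms are normal. [folklore] -/
theorem normalize_of_mem_contrib {t : MvPolynomial X K → HTerm K X} (ht : ∀ u, normalize (t u) = t u)
    (d : StepData K X) {s : HTerm K X} (hs : s ∈ contrib t d) : normalize s = s := by
  cases d with
  | var x => simp only [contrib, Multiset.mem_singleton] at hs; subst hs; simp
  | const c => simp only [contrib, Multiset.mem_singleton] at hs; subst hs; simp
  | sum D =>
    simp only [contrib, Multiset.mem_map] at hs
    obtain ⟨cu, _, rfl⟩ := hs
    exact normalize_mkNode true (by simp [ht])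
  | prod u v =>
    simp only [contrib, Multiset.mem_singleton] at hs; subst hs
    exact normalize_mkNode true (by simp [ht])

/-- The body over normal terms is normal. [folklore] -/
theorem normalize_body {t : MvPolynomial X K → HTerm K X} (ht : ∀ u, normalize (t u) = t u)
    (q : MvPolynomial X K) : normalize (𝒟.body Γ t q) = 𝒟.body Γ t q := by
  refine normalize_mkNode true ?_
  intro s hs
  simp only [Multiset.insert_eq_cons, Multiset.mem_cons, Multiset.mem_singleton] at hs
  rcases hs with rfl | rfl
  · simp
  · refine normalize_mkNode false fun s hs => ?_
    simp only [summands, Multiset.mem_add, Multiset.mem_singleton] at hs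
    rcases hs with rfl | hs
    · simp
    · obtain ⟨w, _, hw⟩ := Multiset.mem_sum.1 hs
      exact normalize_of_mem_contrib ht _ hw

/-- The fuelled terms are normal. [folklore] -/
theorem normalize_tmF : ∀ (k : ℕ) (q : MvPolynomial X K), normalize (𝒟.tmF Γ k q) = 𝒟.tmF Γ k q
  | 0, _ => by simp [tmF]
  | k + 1, q => 𝒟.normalize_body (normalize_tmF k) q

/-- **The canonical terms are normal.** [folklore] -/
theorem normalize_tm (q : MvPolynomial X K) : normalize (𝒟.tm Γ q) = 𝒟.tm Γ q :=
  𝒟.normalize_tmF _ q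

end ValueDerivation

end Summit.ValiantsHypothesis.ValiantsHypothesis.Theorems

end
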